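import Summits.CriticalPhenomena.PercolationContinuityZ3.Theorems.PercNearOneGluingNoHeavyLowerTailSunflowerGraphMarkSteps
import Summits.CriticalPhenomena.PercolationContinuityZ3.Theorems.PercNearOneGluingNoHeavyLowerTailSunflowerWindowKit
import HarnessLib

/-!
# `NoHeavyLowerTail` (crux stmt-CriticalPhenomena-4575), abstract sunflower cubic: graph-mark sunflowers of PROPER 3-edge-colourings —
# common lemmas of the window step (the seven label hypotheses in normal form; the thirteen minors)

Support file (seat `prim-ineq-gen-2` gen 26; `--supports stmt-CriticalPhenomena-4575`).  No `sorry`; nothing is asserted about the crux.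
Memo: run/shared/lean/prim/prim-ineq-gen-2/GRAPHMARK-LEAN-GEN26.md §3–§4.  For a window `p – q – r` (`p q` colour `0`, `q r` colour `1`, `p ≁ r`,
`p, q, r` unmarked) inside a graph-mark sunflower: `IsGraphMarkOn.window_hyps7` turns descriptions `nb c p X = NBp X`, … of the neighbourhoods seen from
the window complement `W'` into the seven hypotheses `h1 … h7` of the generated bricks `…SunflowerWin3P?Q?R?` (normal form of `lab_insert/₂/₃`), and
`window_minors` proves the thirteen proper minors that occur in their conclusions nonnegative from the induction hypothesis (`IsGraphMarkOn.mono/.con`).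
-/

namespace Summit.CriticalPhenomena.PercolationContinuityZ3.Theorems.SunflowerPartition

open Finset

variable {α : Type*} [Fintype α] [DecidableEq α]

/-- The three colours. [this work] -/
theorem fin3_cases : ∀ k : Fin 3, k = 0 ∨ k = 1 ∨ k = 2 := by decide

omit [Fintype α] [DecidableEq α] in
/-- Different colours from the same point go to different points. [this work] -/
theorem ne_of_col_ne {c : α → α → Option (Fin 3)} {x y z : α} {i j : Fin 3} (h1 : c x y = some i) (h2 : c x z = some j) (hij : i ≠ j) : y ≠ z := by
  intro h
  rw [h, h2] at h1
  exact hij (Option.some_injective _ h1).symm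

omit [Fintype α] [DecidableEq α] in
/-- A neighbour differs from a non-neighbour. [this work] -/
theorem ne_of_col_none {c : α → α → Option (Fin 3)} {x y z : α} {i : Fin 3} (h1 : c x y = some i) (h2 : c x z = none) : y ≠ z := by
  intro h
  rw [h, h2] at h1
  exact none_ne_some' i h1

namespace Sunflower

variable {F : Sunflower α} {c : α → α → Option (Fin 3)} {T : α → Finset (Fin 3)} {W : Finset α}

omit [Fintype α] in
/-- **The seven window hypotheses in normal form** from the neighbourhood descriptions of `p, q, r` on the window complement `W'`. [this work] -/
theorem IsGraphMarkOn.window_hyps7 (hF : F.IsGraphMarkOn c T W) (hc : IsProperEdgeColouring c)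
    {p q r : α} (hp : p ∈ W) (hq : q ∈ W) (hr : r ∈ W) (hTp : T p = ∅) (hTq : T q = ∅) (hTr : T r = ∅)
    (h0 : c p q = some 0) (h1 : c q r = some 1) (hpr : c p r = none)
    {W' : Finset α} (hW'W : W' ⊆ W) {NBp NBq NBr : Finset α → Finset (Fin 3)}
    (nbp : ∀ X ⊆ W', nb c p X = NBp X) (nbq : ∀ X ⊆ W', nb c q X = NBq X) (nbr : ∀ X ⊆ W', nb c r X = NBr X) :
    (∀ X ⊆ W', F.lab (insert p X) = joinM (F.lab X) (theta (NBp X))) ∧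
    (∀ X ⊆ W', F.lab (insert q X) = joinM (F.lab X) (theta (NBq X))) ∧
    (∀ X ⊆ W', F.lab (insert p (insert q X)) = joinM (F.lab X) (theta ({0} ∪ (NBp X ∪ NBq X)))) ∧
    (∀ X ⊆ W', F.lab (insert r X) = joinM (F.lab X) (theta (NBr X))) ∧
    (∀ X ⊆ W', F.lab (insert p (insert r X)) = joinM (F.lab X) (theta (∅ ∪ (NBp X ∪ NBr X)))) ∧
    (∀ X ⊆ W', F.lab (insert q (insert r X)) = joinM (F.lab X) (theta ({1} ∪ (NBq X ∪ NBr X)))) ∧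
    (∀ X ⊆ W', F.lab (insert p (insert q (insert r X))) =
      joinM (F.lab X) (theta ({0} ∪ ∅ ∪ {1} ∪ (NBp X ∪ NBq X ∪ NBr X)))) := by
  have hs := hc.symm
  have hi := hc.irrefl
  refine ⟨fun X hX => ?_, fun X hX => ?_, fun X hX => ?_, fun X hX => ?_, fun X hX => ?_, fun X hX => ?_, fun X hX => ?_⟩
  · rw [hF.lab_insert hs hi hp hTp (hX.trans hW'W), nbp X hX]
  · rw [hF.lab_insert hs hi hq hTq (hX.trans hW'W), nbq X hX]
  · rw [hF.lab_insert₂ hs hi hp hq hTp hTq (hX.trans hW'W), h0, Option.toFinset_some, nbp X hX, nbq X hX]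
  · rw [hF.lab_insert hs hi hr hTr (hX.trans hW'W), nbr X hX]
  · rw [hF.lab_insert₂ hs hi hp hr hTp hTr (hX.trans hW'W), hpr, Option.toFinset_none, nbp X hX, nbr X hX]
  · rw [hF.lab_insert₂ hs hi hq hr hTq hTr (hX.trans hW'W), h1, Option.toFinset_some, nbq X hX, nbr X hX]
  · rw [hF.lab_insert₃ hs hi hp hq hr hTp hTq hTr (hX.trans hW'W), h0, hpr, h1, Option.toFinset_some, Option.toFinset_some,
      Option.toFinset_none, nbp X hX, nbq X hX, nbr X hX]

/-- **The thirteen proper minors of a window are nonnegative** by the induction hypothesis inside the class. [this work] -/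
theorem window_minors (hc : IsProperEdgeColouring c) (hF : F.IsGraphMarkOn c T W)
    (hIH : ∀ (F' : Sunflower α) (T' : α → Finset (Fin 3)) (W' : Finset α), #W' < #W → F'.IsGraphMarkOn c T' W' → 0 ≤ F'.ZP W' ∅ ∅ ∅)
    {p q r : α} (hp : p ∈ W) (hq : q ∈ W) (hr : r ∈ W) (hpq : p ≠ q) (hpr : p ≠ r) (hqr : q ≠ r)
    (hTp : T p = ∅) (hTq : T q = ∅) (hTr : T r = ∅) (hcpr : c p r = none)
    {W' : Finset α} (hW'W : W' ⊆ W) (hpW' : p ∉ W') (hqW' : q ∉ W') (hrW' : r ∉ W') (hcard : #W' + 3 = #W) :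
    0 ≤ ((F.con p).con r).ZP W' ∅ ∅ ∅ ∧ 0 ≤ (F.con p).ZP W' ∅ ∅ ∅ ∧ 0 ≤ (F.con p).ZP (insert r W') ∅ ∅ ∅ ∧
    0 ≤ (F.con p).ZP (insert q W') ∅ ∅ ∅ ∧ 0 ≤ (F.con q).ZP W' ∅ ∅ ∅ ∧ 0 ≤ (F.con q).ZP (insert r W') ∅ ∅ ∅ ∧
    0 ≤ (F.con r).ZP W' ∅ ∅ ∅ ∧ 0 ≤ (F.con r).ZP (insert q W') ∅ ∅ ∅ ∧ 0 ≤ F.ZP (insert q (insert r W')) ∅ ∅ ∅ ∧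
    0 ≤ (F.con q).ZP (insert p W') ∅ ∅ ∅ ∧ 0 ≤ (F.con r).ZP (insert p W') ∅ ∅ ∅ ∧ 0 ≤ F.ZP (insert p (insert r W')) ∅ ∅ ∅ ∧
    0 ≤ F.ZP (insert p (insert q W')) ∅ ∅ ∅ := by
  have hs := hc.symm
  have hi := hc.irrefl
  have hW'p : W' ⊆ W.erase p := fun x hx => mem_erase.2 ⟨fun h => hpW' (h ▸ hx), hW'W hx⟩
  have hW'q : W' ⊆ W.erase q := fun x hx => mem_erase.2 ⟨fun h => hqW' (h ▸ hx), hW'W hx⟩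
  have hW'r : W' ⊆ W.erase r := fun x hx => mem_erase.2 ⟨fun h => hrW' (h ▸ hx), hW'W hx⟩
  have cP : (F.con p).IsGraphMarkOn c (addMarks c T p) (W.erase p) := hF.con hs hi hp hTp (erase_subset p W)
  have cQ : (F.con q).IsGraphMarkOn c (addMarks c T q) (W.erase q) := hF.con hs hi hq hTq (erase_subset q W)
  have cR : (F.con r).IsGraphMarkOn c (addMarks c T r) (W.erase r) := hF.con hs hi hr hTr (erase_subset r W)
  have hTr' : addMarks c T p r = ∅ := by
    show T r ∪ (c p r).toFinset = ∅
    rw [hTr, hcpr, Option.toFinset_none, empty_union]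
  have cPR : ((F.con p).con r).IsGraphMarkOn c (addMarks c (addMarks c T p) r) W' :=
    cP.con hs hi (mem_erase.2 ⟨hpr.symm, hr⟩) hTr' hW'p
  have hq1 : q ∈ W.erase p := mem_erase.2 ⟨hpq.symm, hq⟩
  have hrP : r ∈ W.erase p := mem_erase.2 ⟨hpr.symm, hr⟩
  have hrQ : r ∈ W.erase q := mem_erase.2 ⟨hqr.symm, hr⟩
  have hpQ : p ∈ W.erase q := mem_erase.2 ⟨hpq, hp⟩
  have hqR : q ∈ W.erase r := mem_erase.2 ⟨hqr, hq⟩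
  have hpR : p ∈ W.erase r := mem_erase.2 ⟨hpr, hp⟩
  have hqrW' : q ∉ insert r W' := fun h => by
    rcases mem_insert.1 h with h | h
    · exact hqr h
    · exact hqW' h
  have hprW' : p ∉ insert r W' := fun h => by
    rcases mem_insert.1 h with h | h
    · exact hpr h
    · exact hpW' h
  have hpqW' : p ∉ insert q W' := fun h => by
    rcases mem_insert.1 h with h | h
    · exact hpq h
    · exact hpW' h
  have c1q : #(insert q W') = #W' + 1 := card_insert_of_notMem hqW'
  have c1r : #(insert r W') = #W' + 1 := card_insert_of_notMem hrW'
  have c1p : #(insert p W') = #W' + 1 := card_insert_of_notMem hpW'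
  have c2qr : #(insert q (insert r W')) = #W' + 2 := by rw [card_insert_of_notMem hqrW', c1r]
  have c2pr : #(insert p (insert r W')) = #W' + 2 := by rw [card_insert_of_notMem hprW', c1r]
  have c2pq : #(insert p (insert q W')) = #W' + 2 := by rw [card_insert_of_notMem hpqW', c1q]
  refine ⟨hIH _ _ _ (by omega) cPR, hIH _ _ _ (by omega) (cP.mono hW'p), hIH _ _ _ (by omega) (cP.mono (insert_subset hrP hW'p)),
    hIH _ _ _ (by omega) (cP.mono (insert_subset hq1 hW'p)), hIH _ _ _ (by omega) (cQ.mono hW'q),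
    hIH _ _ _ (by omega) (cQ.mono (insert_subset hrQ hW'q)), hIH _ _ _ (by omega) (cR.mono hW'r),
    hIH _ _ _ (by omega) (cR.mono (insert_subset hqR hW'r)), hIH _ _ _ (by omega) (hF.mono (insert_subset hq (insert_subset hr hW'W))),
    hIH _ _ _ (by omega) (cQ.mono (insert_subset hpQ hW'q)), hIH _ _ _ (by omega) (cR.mono (insert_subset hpR hW'r)),
    hIH _ _ _ (by omega) (hF.mono (insert_subset hp (insert_subset hr hW'W))), hIH _ _ _ (by omega) (hF.mono (insert_subset hp (insert_subset hq hW'W)))⟩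

omit [Fintype α] in
/-- Membership in the window complement `W ∖ {p, q, r}`. [this work] -/
theorem mem_window_compl {W : Finset α} {p q r x : α} :
    x ∈ ((W.erase p).erase q).erase r ↔ x ≠ r ∧ x ≠ q ∧ x ≠ p ∧ x ∈ W := by
  rw [mem_erase, mem_erase, mem_erase]

omit [Fintype α] in
/-- The window complement has three points fewer. [this work] -/
theorem card_window_compl {W : Finset α} {p q r : α} (hp : p ∈ W) (hq : q ∈ W) (hr : r ∈ W) (hpq : p ≠ q) (hpr : p ≠ r) (hqr : q ≠ r) :
    #(((W.erase p).erase q).erase r) + 3 = #W ∧ insert p (insert q (insert r (((W.erase p).erase q).erase r))) = W := by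
  have hq1 : q ∈ W.erase p := mem_erase.2 ⟨hpq.symm, hq⟩
  have hr2 : r ∈ (W.erase p).erase q := mem_erase.2 ⟨hqr.symm, mem_erase.2 ⟨hpr.symm, hr⟩⟩
  refine ⟨?_, by rw [insert_erase hr2, insert_erase hq1, insert_erase hp]⟩
  have h3 : #({p, q, r} : Finset α) = 3 := card_eq_three.2 ⟨p, q, r, hpq, hpr, hqr, rfl⟩
  have h3le : #({p, q, r} : Finset α) ≤ #W := card_le_card (insert_subset hp (insert_subset hq (singleton_subset_iff.2 hr)))
  rw [card_erase_of_mem hr2, card_erase_of_mem hq1, card_erase_of_mem hp]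
  omega

end Sunflower

end Summit.CriticalPhenomena.PercolationContinuityZ3.Theorems.SunflowerPartition
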